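import Summits.CriticalPhenomena.PercolationContinuityZ3.Theorems.Transplant.Slab111HubRoute2
import Summits.CriticalPhenomena.PercolationContinuityZ3.Theorems.Transplant.Slab111VGeo
import HarnessLib

/-!
# The HUB ROUTING of the `(111)`-films, V: hub PLANS — relative legs as model chains, and the data of a dispatcher entry (`HubPlan`)

builds on p205010 (kernel theorem, internal audit signed; external expert review pending) — NOT used in this file.  Lane `prim-bschramm`, seat
`prim-bschramm-p2` (gen 36; class C1b; memo `HOME/bschramm/P2-LATTICES.md` §130); helper file (`--supports stmt-CriticalPhenomena-4575 --as helper`).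
The dispatcher of the `(111)`-film instance works with TABLE ENTRIES: three faces with attachment directions and three LEGS given as relative model
chains («Slab111VGeo»: `absV k z ℓ p`, `p = ((Δa, Δb), Δℓ)` relative to the terminal), plus the hub zone.  This file turns such an entry, together with
the side conditions in the form the dispatcher can discharge (column exclusions — decidable on the entry; level separations — linear arithmetic), into
a `HubData` («Slab111HubData») and hence into a swap pair («Slab111HubRoute2».`hub_gml`).
* §1 legs as relative chains: `legV`, `LegOK`, `leg_gpath`, read-back of columns and levels;
* §2 `colAt` from membership and class (`colAt_eq_of_faceMem`; cf. «Slab111VSoundB».`colAt_eq_of_mem`);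
* §3 **`HubPlan`** (the entry + configuration + side conditions) and its first consequences (class consistency, level ranges, the leg ends are the
  ride vertices `eᵢ`).  The `HubData` and the swap pair are built in «Slab111HubBuild».
[cite: DuminilCopinSidoraviciusTassion2016, §2.3 (proof of Fact 2: the three disjoint paths γ_u, γ_v, γ_w in B_R(z))]
-/

noncomputable section

namespace Summit.CriticalPhenomena.PercolationContinuityZ3.Theorems.Transplant

open Literature.Probability.Percolation Literature.Probability.LatticeModels SimpleGraph
open scoped Classical

namespace Slab111

variable {k : ℕ}

/-! ## §1 Legs as relative chains -/

/-- **Well-formed relative leg data**: non-empty, starts at the terminal `((0,0),0)`, an `MStep`-chain, duplicate-free, relatively admissible.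
[folklore] -/
def LegOK (l : List MV) : Prop := l ≠ [] ∧ l.head? = some ((0, 0), 0) ∧ l.IsChain MStep ∧ l.Nodup ∧ ∀ p ∈ l, RAdm p

/-- The film vertices of a relative leg from the terminal over `vcol h q` at level `n`. [folklore] -/
def legV (k : ℕ) (h : Site 2) (q : ℤ × ℤ) (n : ℤ) (l : List MV) : List (slab111 k) := l.map (absV k (vcol h q) n)

/-- `vcol` and integer-pair addition. [folklore] -/
theorem vcol_add (h : Site 2) (q p : ℤ × ℤ) : vcol h q + ![p.1, p.2] = vcol h (q + p) := by
  ext i; fin_cases i <;> simp [vcol, Matrix.vecHead, Matrix.vecTail] <;> ring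

/-- The relative origin is the terminal itself. [folklore] -/
theorem absV_zero (z : Site 2) (ℓ : ℤ) : absV k z ℓ (((0 : ℤ), (0 : ℤ)), (0 : ℤ)) = vl k z ℓ := by
  unfold absV toV shiftMV
  simp only [add_zero]
  congr 1; ext i; fin_cases i <;> simp [mcol]

/-- Class consistency of the terminal position gives the divisibility `gpath_of_relchain` wants. [folklore] -/
theorem dvd_base {h : Site 2} {c0 : ℤ} (hz : (3 : ℤ) ∣ h 0 + 2 * h 1 - c0) {q : ℤ × ℤ} {n : ℤ} (hq : (3 : ℤ) ∣ n - c0 - (q.1 + 2 * q.2)) :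
    (3 : ℤ) ∣ n - ((vcol h q) 0 + 2 * (vcol h q) 1) := by
  have e : n - ((vcol h q) 0 + 2 * (vcol h q) 1) = (n - c0 - (q.1 + 2 * q.2)) - (h 0 + 2 * h 1 - c0) := by
    simp only [vcol_apply_zero, vcol_apply_one]; ring
  rw [e]; exact dvd_sub hq hz

/-- Admissibility of a leg vertex. [folklore] -/
theorem madm_leg {h : Site 2} {c0 : ℤ} (hz : (3 : ℤ) ∣ h 0 + 2 * h 1 - c0) {q : ℤ × ℤ} {n : ℤ} (hq : (3 : ℤ) ∣ n - c0 - (q.1 + 2 * q.2))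
    {p : MV} (hp : RAdm p) (h0 : 0 ≤ n + p.2) (hk : n + p.2 ≤ k) : MAdm k (shiftMV (vcol h q) n p) :=
  madm_shift (dvd_base hz hq) hp h0 hk

/-- Shadow and level of a leg vertex. [folklore] -/
theorem sh_lev_legV {h : Site 2} {c0 : ℤ} (hz : (3 : ℤ) ∣ h 0 + 2 * h 1 - c0) {q : ℤ × ℤ} {n : ℤ} (hq : (3 : ℤ) ∣ n - c0 - (q.1 + 2 * q.2))
    {p : MV} (hp : RAdm p) (h0 : 0 ≤ n + p.2) (hk : n + p.2 ≤ k) :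
    sh (absV k (vcol h q) n p) = vcol h (q + p.1) ∧ lev ((absV k (vcol h q) n p : slab111 k) : Site 3) = n + p.2 := by
  have hm := madm_leg (k := k) hz hq hp h0 hk
  exact ⟨by rw [sh_absV hm, vcol_add], lev_absV hm⟩

/-- **A well-formed leg with levels in range is a self-avoiding film path** from the terminal `vl k (vcol h q) n` to its last vertex. [folklore] -/
theorem leg_gpath {h : Site 2} {c0 : ℤ} (hz : (3 : ℤ) ∣ h 0 + 2 * h 1 - c0) {q : ℤ × ℤ} {n : ℤ} (hq : (3 : ℤ) ∣ n - c0 - (q.1 + 2 * q.2))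
    {l : List MV} (hl : LegOK l) (hr : ∀ p ∈ l, 0 ≤ n + p.2 ∧ n + p.2 ≤ k) :
    GPath (film k) (legV k h q n l) (vl k (vcol h q) n) (absV k (vcol h q) n (l.getLast hl.1)) := by
  obtain ⟨hne, hhead, hch, hnd, hadm⟩ := hl
  have g := gpath_of_relchain (k := k) (dvd_base hz hq) hne hadm hr hch hnd
  have hh : l.head hne = ((0, 0), 0) := by
    obtain ⟨x, xs, hx⟩ := List.exists_cons_of_ne_nil hne
    subst hx
    simpa using hhead
  rw [hh, absV_zero] at g; exact g

/-- Membership in a leg: every vertex is `absV` of an entry. [folklore] -/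
theorem mem_legV {h : Site 2} {q : ℤ × ℤ} {n : ℤ} {l : List MV} {v : slab111 k} : v ∈ legV k h q n l ↔ ∃ p ∈ l, v = absV k (vcol h q) n p := by
  unfold legV; rw [List.mem_map]
  constructor
  · rintro ⟨p, hp, rfl⟩; exact ⟨p, hp, rfl⟩
  · rintro ⟨p, hp, rfl⟩; exact ⟨p, hp, rfl⟩

/-! ## §2 `colAt` from membership -/

/-- **A column of a well-formed face is `colAt` of its class.** [folklore] -/
theorem colAt_eq_of_faceMem {F : FaceD} (hF : F.ok) {c : ℤ × ℤ} (hc : c = F.f0 ∨ c = F.f1 ∨ c = F.f2) {m : ℤ} (hm : (3 : ℤ) ∣ c.1 + 2 * c.2 - m) :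
    colAt F m = c := by
  obtain ⟨h0, h1, h2, -, -, -⟩ := hF
  unfold colAt
  rcases hc with rfl | rfl | rfl
  · have : m % 3 = 0 := by omega
    simp [this]
  · have : m % 3 = 1 := by omega
    simp [this]
  · have e1 : m % 3 ≠ 0 := by omega
    have e2 : m % 3 ≠ 1 := by omega
    simp [e1, e2]

/-- The three columns of a face, as a membership test on integer pairs. [folklore] -/
def FaceD.mem (F : FaceD) (c : ℤ × ℤ) : Prop := c = F.f0 ∨ c = F.f1 ∨ c = F.f2

/-- `FaceD.mem` is decidable. [folklore] -/
instance (F : FaceD) (c : ℤ × ℤ) : Decidable (F.mem c) := by unfold FaceD.mem; infer_instance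

/-- Off the columns of a face in relative coordinates gives `OffCols`. [folklore] -/
theorem offCols_of_not_mem {h : Site 2} {F : FaceD} {c : ℤ × ℤ} (hc : ¬ F.mem c) {x : slab111 k} (hx : sh x = vcol h c) : OffCols h F x := by
  have hinj := vcol_injective h
  refine ⟨?_, ?_, ?_⟩ <;> rw [hx] <;> intro e <;> apply hc
  · exact Or.inl (hinj e)
  · exact Or.inr (Or.inl (hinj e))
  · exact Or.inr (Or.inr (hinj e))

/-! ## §3 Hub plans -/

/-- **A HUB PLAN**: a table entry of the dispatcher (faces `F1 F2 F3` with attachment directions, relative legs `l₁ l₂ l₃`) instantiated at a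
configuration (terminal columns `qᵢ` relative to the hub `h`, levels `nᵢ`) with a hub zone (`LA`, `LD = LA + 3τ`), together with the side conditions in
dischargeable form: bulk membership of the region columns, level ranges of the legs, column-or-level separation of every leg vertex from the other
faces' ride windows, from the hubs and from the other legs. [cite: DuminilCopinSidoraviciusTassion2016, §2.3 (proof of Fact 2: γ_u, γ_v, γ_w)] -/
structure HubPlan (k : ℕ) (h : Site 2) (c0 : ℤ) (W PR : Set (slab111 k)) (E₁ E₂ w' : slab111 k) where
  /-- region columns (relative to the hub): bulk vertices over `Pc` lie in `PR`, over `Wc` in `W` -/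
  (Pc Wc : List (ℤ × ℤ))
  /-- terminal columns and levels -/
  (q₁ q₂ q₃ : ℤ × ℤ) (n₁ n₂ n₃ : ℤ)
  /-- faces and attachment directions -/
  (F1 F2 F3 : FaceD) (d₁ d₂ d₃ : ℤ)
  /-- relative legs -/
  (l₁ l₂ l₃ : List MV)
  /-- hub zone -/
  (LA LD τ : ℤ)
  hz : (3 : ℤ) ∣ h 0 + 2 * h 1 - c0
  hPRW : PR ⊆ W
  hPc : ∀ q ∈ Pc, ∀ L : ℤ, 1 ≤ L → L ≤ (k : ℤ) - 1 → (3 : ℤ) ∣ L - c0 - (q.1 + 2 * q.2) → vl k (vcol h q) L ∈ PR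
  hWc : ∀ q ∈ Wc, ∀ L : ℤ, 1 ≤ L → L ≤ (k : ℤ) - 1 → (3 : ℤ) ∣ L - c0 - (q.1 + 2 * q.2) → vl k (vcol h q) L ∈ W
  hE1 : sh E₁ = vcol h q₁ ∧ lev (E₁ : Site 3) = n₁
  hE2 : sh E₂ = vcol h q₂ ∧ lev (E₂ : Site 3) = n₂
  hE3 : sh w' = vcol h q₃ ∧ lev (w' : Site 3) = n₃
  hE1P : E₁ ∈ PR
  hE2P : E₂ ∈ PR
  hE3W : w' ∈ W
  hne : E₁ ≠ E₂
  hF1 : F1.ok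
  hF2 : F2.ok
  hF3 : F3.ok
  ho1 : F1.OffHub
  ho2 : F2.OffHub
  ho3 : F3.OffHub
  h12 : F1.Disj F2
  h13 : F1.Disj F3
  h23 : F2.Disj F3
  hA1 : Att F1 d₁
  hA2 : Att F2 d₂
  hA3 : Att F3 d₃
  hF1P : F1.f0 ∈ Pc ∧ F1.f1 ∈ Pc ∧ F1.f2 ∈ Pc
  hF2P : F2.f0 ∈ Pc ∧ F2.f1 ∈ Pc ∧ F2.f2 ∈ Pc
  hF3W : F3.f0 ∈ Wc ∧ F3.f1 ∈ Wc ∧ F3.f2 ∈ Wc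
  /-- the hub column is a rerouting-region column -/
  hub_mem : ((0 : ℤ), (0 : ℤ)) ∈ Pc
  hl1 : LegOK l₁
  hl2 : LegOK l₂
  hl3 : LegOK l₃
  /-- the legs end on their faces -/
  he1 : F1.mem (q₁ + (l₁.getLast hl1.1).1)
  he2 : F2.mem (q₂ + (l₂.getLast hl2.1).1)
  he3 : F3.mem (q₃ + (l₃.getLast hl3.1).1)
  /-- the other leg vertices are off their own face and over region columns, at levels in `[1, k−1]` -/
  ho1' : ∀ p ∈ l₁, p ≠ l₁.getLast hl1.1 → ¬ F1.mem (q₁ + p.1)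
  ho2' : ∀ p ∈ l₂, p ≠ l₂.getLast hl2.1 → ¬ F2.mem (q₂ + p.1)
  ho3' : ∀ p ∈ l₃, p ≠ l₃.getLast hl3.1 → ¬ F3.mem (q₃ + p.1)
  hc1 : ∀ p ∈ l₁, p ≠ ((0, 0), 0) → q₁ + p.1 ∈ Pc ∧ 1 ≤ n₁ + p.2 ∧ n₁ + p.2 ≤ (k : ℤ) - 1
  hc2 : ∀ p ∈ l₂, p ≠ ((0, 0), 0) → q₂ + p.1 ∈ Pc ∧ 1 ≤ n₂ + p.2 ∧ n₂ + p.2 ≤ (k : ℤ) - 1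
  hc3 : ∀ p ∈ l₃, p ≠ ((0, 0), 0) → q₃ + p.1 ∈ Wc ∧ 1 ≤ n₃ + p.2 ∧ n₃ + p.2 ≤ (k : ℤ) - 1
  hn1 : 0 ≤ n₁ ∧ n₁ ≤ k
  hn2 : 0 ≤ n₂ ∧ n₂ ≤ k
  hn3 : 0 ≤ n₃ ∧ n₃ ≤ k
  /-- the zone -/
  hτ : τ = 1 ∨ τ = -1
  hLD : LD = LA + 3 * τ
  hLA : (3 : ℤ) ∣ LA - c0
  hLA2 : 2 ≤ LA
  hLAk : LA ≤ (k : ℤ) - 2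
  hLD2 : 2 ≤ LD
  hLDk : LD ≤ (k : ℤ) - 2
  /-- `e₁` is before `c = att(F1, H_A)` in the direction `τ` -/
  hside : 0 ≤ τ * (LA + d₁ - (n₁ + (l₁.getLast hl1.1).2))
  /-- separation of the legs from the OTHER faces: off their columns, or outside their window -/
  s21 : ∀ p ∈ l₁, p ≠ l₁.getLast hl1.1 → ¬ F2.mem (q₁ + p.1) ∨ n₁ + p.2 < min (n₂ + (l₂.getLast hl2.1).2) (min LA LD - 1) ∨
    max (n₂ + (l₂.getLast hl2.1).2) (max LA LD + 1) < n₁ + p.2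
  s31 : ∀ p ∈ l₁, p ≠ l₁.getLast hl1.1 → ¬ F3.mem (q₁ + p.1) ∨ n₁ + p.2 < min (n₃ + (l₃.getLast hl3.1).2) (min LA LD - 1) ∨
    max (n₃ + (l₃.getLast hl3.1).2) (max LA LD + 1) < n₁ + p.2
  s12 : ∀ p ∈ l₂, p ≠ l₂.getLast hl2.1 → ¬ F1.mem (q₂ + p.1) ∨ n₂ + p.2 < min (n₁ + (l₁.getLast hl1.1).2) (min LA LD - 1) ∨
    max (n₁ + (l₁.getLast hl1.1).2) (max LA LD + 1) < n₂ + p.2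
  s32 : ∀ p ∈ l₂, p ≠ l₂.getLast hl2.1 → ¬ F3.mem (q₂ + p.1) ∨ n₂ + p.2 < min (n₃ + (l₃.getLast hl3.1).2) (min LA LD - 1) ∨
    max (n₃ + (l₃.getLast hl3.1).2) (max LA LD + 1) < n₂ + p.2
  s13 : ∀ p ∈ l₃, p ≠ l₃.getLast hl3.1 → ¬ F1.mem (q₃ + p.1) ∨ n₃ + p.2 < min (n₁ + (l₁.getLast hl1.1).2) (min LA LD - 1) ∨
    max (n₁ + (l₁.getLast hl1.1).2) (max LA LD + 1) < n₃ + p.2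
  s23 : ∀ p ∈ l₃, p ≠ l₃.getLast hl3.1 → ¬ F2.mem (q₃ + p.1) ∨ n₃ + p.2 < min (n₂ + (l₂.getLast hl2.1).2) (min LA LD - 1) ∨
    max (n₂ + (l₂.getLast hl2.1).2) (max LA LD + 1) < n₃ + p.2
  /-- leg vertices are not the hubs -/
  hh1 : ∀ p ∈ l₁, p ≠ l₁.getLast hl1.1 → q₁ + p.1 ≠ (0, 0) ∨ (n₁ + p.2 ≠ LA ∧ n₁ + p.2 ≠ LD)
  hh2 : ∀ p ∈ l₂, p ≠ l₂.getLast hl2.1 → q₂ + p.1 ≠ (0, 0) ∨ (n₂ + p.2 ≠ LA ∧ n₂ + p.2 ≠ LD)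
  hh3 : ∀ p ∈ l₃, p ≠ l₃.getLast hl3.1 → q₃ + p.1 ≠ (0, 0) ∨ (n₃ + p.2 ≠ LA ∧ n₃ + p.2 ≠ LD)
  /-- leg vertices are pairwise distinct across legs -/
  d12 : ∀ p ∈ l₁, p ≠ l₁.getLast hl1.1 → ∀ p' ∈ l₂, p' ≠ l₂.getLast hl2.1 → (q₁ + p.1, n₁ + p.2) ≠ (q₂ + p'.1, n₂ + p'.2)
  d13 : ∀ p ∈ l₁, p ≠ l₁.getLast hl1.1 → ∀ p' ∈ l₃, p' ≠ l₃.getLast hl3.1 → (q₁ + p.1, n₁ + p.2) ≠ (q₃ + p'.1, n₃ + p'.2)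
  d23 : ∀ p ∈ l₂, p ≠ l₂.getLast hl2.1 → ∀ p' ∈ l₃, p' ≠ l₃.getLast hl3.1 → (q₂ + p.1, n₂ + p.2) ≠ (q₃ + p'.1, n₃ + p'.2)

namespace HubPlan

variable {h : Site 2} {c0 : ℤ} {W PR : Set (slab111 k)} {E₁ E₂ w' : slab111 k} (P : HubPlan k h c0 W PR E₁ E₂ w')

/-- The level of `e₁`. [folklore] -/
def ℓ₁ : ℤ := P.n₁ + (P.l₁.getLast P.hl1.1).2
/-- The level of `e₂`. [folklore] -/
def ℓ₂ : ℤ := P.n₂ + (P.l₂.getLast P.hl2.1).2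
/-- The level of `e₃`. [folklore] -/
def ℓ₃ : ℤ := P.n₃ + (P.l₃.getLast P.hl3.1).2

/-- Class consistency of the terminals (they are film vertices over the stated columns at the stated levels). [folklore] -/
theorem hq1 : (3 : ℤ) ∣ P.n₁ - c0 - (P.q₁.1 + 2 * P.q₁.2) := by
  have ha := (exists_eq_vl E₁).1
  obtain ⟨hd, -, -⟩ := ha
  rw [P.hE1.1, P.hE1.2] at hd
  have e : P.n₁ - c0 - (P.q₁.1 + 2 * P.q₁.2) = (P.n₁ - lvl (vcol h P.q₁)) + (h 0 + 2 * h 1 - c0) := by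
    simp only [lvl, vcol_apply_zero, vcol_apply_one]; ring
  rw [e]; exact dvd_add hd P.hz

/-- Class consistency of `E₂`. [folklore] -/
theorem hq2 : (3 : ℤ) ∣ P.n₂ - c0 - (P.q₂.1 + 2 * P.q₂.2) := by
  have ha := (exists_eq_vl E₂).1
  obtain ⟨hd, -, -⟩ := ha
  rw [P.hE2.1, P.hE2.2] at hd
  have e : P.n₂ - c0 - (P.q₂.1 + 2 * P.q₂.2) = (P.n₂ - lvl (vcol h P.q₂)) + (h 0 + 2 * h 1 - c0) := by
    simp only [lvl, vcol_apply_zero, vcol_apply_one]; ring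
  rw [e]; exact dvd_add hd P.hz

/-- Class consistency of `w'`. [folklore] -/
theorem hq3 : (3 : ℤ) ∣ P.n₃ - c0 - (P.q₃.1 + 2 * P.q₃.2) := by
  have ha := (exists_eq_vl w').1
  obtain ⟨hd, -, -⟩ := ha
  rw [P.hE3.1, P.hE3.2] at hd
  have e : P.n₃ - c0 - (P.q₃.1 + 2 * P.q₃.2) = (P.n₃ - lvl (vcol h P.q₃)) + (h 0 + 2 * h 1 - c0) := by
    simp only [lvl, vcol_apply_zero, vcol_apply_one]; ring
  rw [e]; exact dvd_add hd P.hz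

/-- Level range of every leg vertex. [folklore] -/
theorem rng1 : ∀ p ∈ P.l₁, 0 ≤ P.n₁ + p.2 ∧ P.n₁ + p.2 ≤ k := by
  intro p hp
  by_cases h0 : p = ((0, 0), 0)
  · subst h0; simpa using P.hn1
  · have := P.hc1 p hp h0; exact ⟨by omega, by omega⟩

/-- Level range of every vertex of `l₂`. [folklore] -/
theorem rng2 : ∀ p ∈ P.l₂, 0 ≤ P.n₂ + p.2 ∧ P.n₂ + p.2 ≤ k := by
  intro p hp
  by_cases h0 : p = ((0, 0), 0)
  · subst h0; simpa using P.hn2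
  · have := P.hc2 p hp h0; exact ⟨by omega, by omega⟩

/-- Level range of every vertex of `l₃`. [folklore] -/
theorem rng3 : ∀ p ∈ P.l₃, 0 ≤ P.n₃ + p.2 ∧ P.n₃ + p.2 ≤ k := by
  intro p hp
  by_cases h0 : p = ((0, 0), 0)
  · subst h0; simpa using P.hn3
  · have := P.hc3 p hp h0; exact ⟨by omega, by omega⟩

/-- `E₁` as `vl`. [folklore] -/
theorem E1_eq : E₁ = vl k (vcol h P.q₁) P.n₁ := by
  have := (exists_eq_vl E₁).2; rw [P.hE1.1, P.hE1.2] at this; exact this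
/-- `E₂` as `vl`. [folklore] -/
theorem E2_eq : E₂ = vl k (vcol h P.q₂) P.n₂ := by
  have := (exists_eq_vl E₂).2; rw [P.hE2.1, P.hE2.2] at this; exact this
/-- `w'` as `vl`. [folklore] -/
theorem E3_eq : w' = vl k (vcol h P.q₃) P.n₃ := by
  have := (exists_eq_vl w').2; rw [P.hE3.1, P.hE3.2] at this; exact this

/-- The last vertex of `l₁` is the ride vertex `e₁ = rideV F1 ℓ₁`. [folklore] -/
theorem last1_eq : absV k (vcol h P.q₁) P.n₁ (P.l₁.getLast P.hl1.1) = rideV k h c0 P.F1 P.ℓ₁ := by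
  set p := P.l₁.getLast P.hl1.1
  have hp : p ∈ P.l₁ := List.getLast_mem _
  obtain ⟨hs, hl⟩ := sh_lev_legV (k := k) P.hz P.hq1 (P.hl1.2.2.2.2 p hp) (P.rng1 p hp).1 (P.rng1 p hp).2
  refine rideV_eq_of_sh_lev P.hz P.hF1 (by have := (P.rng1 p hp).1; unfold ℓ₁; omega) (by have := (P.rng1 p hp).2; unfold ℓ₁; omega) ?_ hl
  rw [hs, colAt_eq_of_faceMem P.hF1 P.he1]
  have h1 := P.hq1; have h2 := P.hl1.2.2.2.2 p hp
  unfold RAdm at h2; unfold ℓ₁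
  have e : (P.q₁ + p.1).1 + 2 * (P.q₁ + p.1).2 - (P.n₁ + p.2 - c0) =
      -(P.n₁ - c0 - (P.q₁.1 + 2 * P.q₁.2)) - (p.2 - (p.1.1 + 2 * p.1.2)) := by simp only [Prod.fst_add, Prod.snd_add]; ring
  rw [e]; exact dvd_sub (dvd_neg.2 h1) h2

/-- The last vertex of `l₂` is `e₂`. [folklore] -/
theorem last2_eq : absV k (vcol h P.q₂) P.n₂ (P.l₂.getLast P.hl2.1) = rideV k h c0 P.F2 P.ℓ₂ := by
  set p := P.l₂.getLast P.hl2.1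
  have hp : p ∈ P.l₂ := List.getLast_mem _
  obtain ⟨hs, hl⟩ := sh_lev_legV (k := k) P.hz P.hq2 (P.hl2.2.2.2.2 p hp) (P.rng2 p hp).1 (P.rng2 p hp).2
  refine rideV_eq_of_sh_lev P.hz P.hF2 (by have := (P.rng2 p hp).1; unfold ℓ₂; omega) (by have := (P.rng2 p hp).2; unfold ℓ₂; omega) ?_ hl
  rw [hs, colAt_eq_of_faceMem P.hF2 P.he2]
  have h1 := P.hq2; have h2 := P.hl2.2.2.2.2 p hp
  unfold RAdm at h2; unfold ℓ₂
  have e : (P.q₂ + p.1).1 + 2 * (P.q₂ + p.1).2 - (P.n₂ + p.2 - c0) =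
      -(P.n₂ - c0 - (P.q₂.1 + 2 * P.q₂.2)) - (p.2 - (p.1.1 + 2 * p.1.2)) := by simp only [Prod.fst_add, Prod.snd_add]; ring
  rw [e]; exact dvd_sub (dvd_neg.2 h1) h2

/-- The last vertex of `l₃` is `e₃`. [folklore] -/
theorem last3_eq : absV k (vcol h P.q₃) P.n₃ (P.l₃.getLast P.hl3.1) = rideV k h c0 P.F3 P.ℓ₃ := by
  set p := P.l₃.getLast P.hl3.1
  have hp : p ∈ P.l₃ := List.getLast_mem _
  obtain ⟨hs, hl⟩ := sh_lev_legV (k := k) P.hz P.hq3 (P.hl3.2.2.2.2 p hp) (P.rng3 p hp).1 (P.rng3 p hp).2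
  refine rideV_eq_of_sh_lev P.hz P.hF3 (by have := (P.rng3 p hp).1; unfold ℓ₃; omega) (by have := (P.rng3 p hp).2; unfold ℓ₃; omega) ?_ hl
  rw [hs, colAt_eq_of_faceMem P.hF3 P.he3]
  have h1 := P.hq3; have h2 := P.hl3.2.2.2.2 p hp
  unfold RAdm at h2; unfold ℓ₃
  have e : (P.q₃ + p.1).1 + 2 * (P.q₃ + p.1).2 - (P.n₃ + p.2 - c0) =
      -(P.n₃ - c0 - (P.q₃.1 + 2 * P.q₃.2)) - (p.2 - (p.1.1 + 2 * p.1.2)) := by simp only [Prod.fst_add, Prod.snd_add]; ring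
  rw [e]; exact dvd_sub (dvd_neg.2 h1) h2

end HubPlan

end Slab111

end Summit.CriticalPhenomena.PercolationContinuityZ3.Theorems.Transplant

end
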